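import Mathlib.Analysis.SpecialFunctions.Elliptic.Weierstrass
import Mathlib.RingTheory.Algebraic.Basic
import Mathlib.RingTheory.Algebraic.Integral
import Mathlib.Analysis.SpecialFunctions.Complex.Log
import HarnessLib

/-!
# A non-zero elliptic period is not in the `ℚ̄`-span of `1` and logarithms of algebraic numbers

Topic: `Literature/NumberTheory/Transcendental`. LIGHT module (imports: Mathlib's Weierstrass
`PeriodPair`, `IsAlgebraic` (`Algebraic.Basic`, `Algebraic.Integral` for closure under `−, ·`),
`Complex.exp/log`, and `HarnessLib` only; nothing from `Literature/`) vendoring ONE named fact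
requested by route `KontsevichZagierPeriods/HodgeLevel` (`wi-16003`, crux
`OnePeriodNeedsTwoVariables`; also useful to `HermiteRigidity` / `LowDimension`), so that routes
taking it as a hypothesis `(h : ellipticPeriod_not_mem_logSpan)` do not inherit the import cone
of `AnalyticSubgroupElliptic` / `OnePeriods` / `BakerLogarithms`.

## The fact

`Literature.NumberTheory.Transcendental.ellipticPeriod_not_mem_logSpan`: for a period pair `L`
(Mathlib `PeriodPair`, lattice `Λ = ℤω₁ + ℤω₂ = L.lattice`) whose invariants
`g₂(L) = 60 G₄`, `g₃(L) = 140 G₆` are algebraic — i.e. `E : y² = 4x³ − g₂x − g₃` is an elliptic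
curve over `ℚ̄`, uniformised by `(℘_L, ℘′_L)` (`PeriodPair.derivWeierstrassP_sq`), so that `Λ`
is exactly the lattice of periods `∫_γ dx/y`, `γ ∈ H₁(E(ℂ), ℤ)` — complex multiplication
ALLOWED, no non-zero `ω ∈ Λ` lies in the `ℚ̄`-span of `1` and of logarithms of algebraic
numbers: for all `k`, `β₀, β₁, …, β_k ∈ ℚ̄` and `y₁, …, y_k ∈ ℂ` with `e^{yᵢ} ∈ ℚ̄`,
`ω ≠ β₀ + Σ βᵢ yᵢ`. (The `yᵢ` may be any branches, may repeat, may be `0` or rational multiples of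
`2πi`: `e^{2πi m/n} ∈ ℚ̄`.)

## Why this is a consequence of the printed theorems (never stronger)

Huber–Wüstholz 2022 (Cambridge Tract 227), **Theorem 15.3 (1)** (= Thm. 1.5 of the
Introduction; structure statement Thm. 1.4 = Cor. 16.4 + Prop. 16.5): for a 1-motive
`M = M₀ × M₁` over `ℚ̄` with `M₀ = [L₀ → T₀]` of Baker type and `M₁` saturated, with torus
part `T`, abelian part `A`, lattice `L`,
`δ(M) := dim_ℚ̄ 𝒫⟨M⟩ = δ(T) + Σ_B 4g(B)²/e(B) + δ(L) + Σ_B (2g(B) rk_B(T,M) + 2g(B) rk_B(L,M))`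
`+ rk_{𝔾ₘ}(L₀, M₀) + (a last sum over B each of whose terms carries the factor rk_B(L, M))`,
with `δ(T), δ(L) ∈ {0,1}` according to `T, L ≠ 0` (Thm. 15.3 (3)); the sums run over the simple
factors `B` of `A`. Apply it to `M = [ℤ^r → 𝔾ₘ^r] × [0 → E]`, `1_j ↦ αⱼ` with
`α₁, …, α_r ∈ ℚ̄ˣ` multiplicatively independent (`M₀ = [ℤ^r → 𝔾ₘ^r]` is of Baker type,
Def. 15.1 (1); `M₁ = [0 → E]` is reduced and saturated, Def. 15.1 (4)–(5), `End(M₁)_ℚ = End(E)_ℚ`;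
if `r = 0` use `M₀ = [ℤ → 𝔾ₘ]`, `1 ↦ 1`). Here `G = 𝔾ₘ^r × E` is split and `L → E` is zero, so
`rk_E(T, M) = rk_E(L, M) = 0` (Notation 15.2), `rk_{𝔾ₘ}(L₀, M₀) = rk ⟨α₁, …, α_r⟩ = r`,
`e = e(E) ∈ {1, 2}` (`2` iff CM), whence `δ(M) = 1 + 4/e + 1 + 0 + r + 0 = 2 + 4/e + r`. The
period space is `𝒫⟨M⟩ = 𝒫⟨M₀⟩ + 𝒫⟨M₁⟩ = ℚ̄·1 + ℚ̄·2πi + Σⱼ ℚ̄ log αⱼ + 𝒫⟨E⟩` (Baker type: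
§15.3.1, Prop. 15.10 "Baker's Theorem"; elliptic periods `𝒫⟨E⟩ = ℚ̄ω₁ + ℚ̄ω₂ + ℚ̄η₁ + ℚ̄η₂`:
§18.1–18.2 and §18.5, Def. 18.7, Prop. 18.8), and `dim 𝒫⟨E⟩ = 4/e` (the same formula for
`[0 → E]`; Thm. 18.9, Cor. 18.10). Choosing a basis
of `𝒫⟨E⟩` through `ω ≠ 0`, the `2 + r + 4/e` listed generators of `𝒫⟨M⟩` are therefore a
`ℚ̄`-BASIS, so `ω ∉ ℚ̄ + ℚ̄·2πi + Σⱼ ℚ̄ log αⱼ`. Finally, for arbitrary `y₁, …, y_k` with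
`e^{yᵢ} ∈ ℚ̄`: pick a maximal multiplicatively independent subfamily `(αⱼ)_{j ∈ J}` of the
`e^{yᵢ}` modulo roots of unity; each `yᵢ` lies in `Σ_{j∈J} ℚ yⱼ + ℚ·πi` (if
`αᵢ^N = ζ Π αⱼ^{m_j}` with `ζ^{N'} = 1` then `N N' yᵢ − Σ N' m_j yⱼ ∈ 2πiℤ`), so a relation
`ω = β₀ + Σ βᵢ yᵢ` would put `ω` in `ℚ̄ + ℚ̄·2πi + Σ_{j∈J} ℚ̄ yⱼ`, excluded above. The same
conclusion is the analytic subgroup theorem (Wüstholz 1989; Baker–Wüstholz 2007, Thm. 6.1 and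
§6.1–6.2) for `G = 𝔾ₐ × 𝔾ₘ^k × E`, `u = (1, y, ω)`, `exp_G(u) = (1, α, O) ∈ G(ℚ̄)`: a connected
algebraic subgroup `H ⊆ G` with `u ∈ Lie H` contains `0 × 0 × E` (its image in `E` is `E`
because the `E`-coordinate `ω` of `u` is non-zero, and a connected subgroup of `G` surjecting
onto `E` with `H ∩ E` finite would be affine), so `Lie H` is not inside a hyperplane with
non-zero `E`-coefficient. Special cases in print: `k = 0` is Siegel–Schneider (non-zero periods
are transcendental; Baker–Wüstholz 2007, end of §6.1), and `ω ∉ ℚ̄·π` is Schneider 1937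
(`π/ω` transcendental; Huber–Wüstholz 2022, Prologue).

## Contents

* `ellipticPeriod_not_mem_logSpan` — the named fact (a `def … : Prop`; users take it as a
  hypothesis; no `_holds` here: a discharge needs the analytic subgroup theorem, cf.
  `Literature.NumberTheory.Transcendental.analyticSubgroupTheorem_GaGmE` in
  `AnalyticSubgroupElliptic.lean`, deliberately NOT imported).
* Proved specialisations: `ellipticPeriod_not_mem_logSpan.transcendental` (`k = 0`:
  non-zero periods are transcendental), `.ne_add_mul_log` (one logarithm),
  `.ne_algebraic_mul_pi` (`ω ∉ ℚ̄·π`, via `y = πi`, `e^{πi} = −1`).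

## References

* A. Huber, G. Wüstholz, *Transcendence and Linear Relations of 1-Periods*, Cambridge Tracts
  in Math. 227, CUP 2022: Thm. 1.4, Thm. 1.5 (Introduction), Def. 15.1, Notation 15.2,
  Thm. 15.3, §15.3.1 with Prop. 15.10 (Baker type), §18.1–18.2 (elliptic periods and
  quasi-periods), §18.5 (Def. 18.7, Prop. 18.8, Thm. 18.9, Cor. 18.10).
  [HuberWustholz2022]
* A. Baker, G. Wüstholz, *Logarithmic Forms and Diophantine Geometry*, New Math. Monogr. 9,
  CUP 2007: Thm. 6.1 (analytic subgroup theorem), §6.1 (transcendence of non-zero periods,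
  end of §6.1), §6.2 (Thms. 6.2–6.7). [BakerWustholz2007]
* G. Wüstholz, *Algebraische Punkte auf analytischen Untergruppen algebraischer Gruppen*,
  Ann. of Math. 129 (1989), 501–517. [Wustholz1989]
-/

noncomputable section

open Complex

namespace Literature.NumberTheory.Transcendental

/-- NAMED FACT — **a non-zero elliptic period is not a `ℚ̄`-linear combination of `1` and
logarithms of algebraic numbers** (complex multiplication allowed). For a period pair `L` with
algebraic invariants `g₂(L), g₃(L)` (so `E : y² = 4x³ − g₂x − g₃` is an elliptic curve over `ℚ̄`
with period lattice `L.lattice` for `dx/y`), every non-zero `ω ∈ L.lattice`, every `k`, all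
algebraic `β₀, β₁, …, β_k` and all `y₁, …, y_k ∈ ℂ` with `exp yᵢ` algebraic satisfy
`ω ≠ β₀ + Σᵢ βᵢ yᵢ`. Instance of the Huber–Wüstholz dimension formula for the 1-motive
`[ℤ^r → 𝔾ₘ^r] × [0 → E]` (`δ = 2 + 4/e(E) + r`; see the module docstring for the reduction of
arbitrary `yᵢ` to multiplicatively independent `e^{yⱼ}`), equivalently of Wüstholz's analytic
subgroup theorem for `𝔾ₐ × 𝔾ₘ^k × E` at `u = (1, y, ω)`. Users take
`(h : ellipticPeriod_not_mem_logSpan)`.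
[cite: HuberWustholz2022, Thm. 15.3(1) (= Thm. 1.5; with Thm. 1.4 = Cor. 16.4 + Prop. 16.5) applied to M = [ℤ^r → 𝔾ₘ^r] × [0 → E]: δ(M) = δ(T) + 4/e + δ(L) + rk_𝔾ₘ = 2 + 4/e + r; §18.5, Thm. 18.9] -/
def ellipticPeriod_not_mem_logSpan : Prop :=
  ∀ (L : PeriodPair), IsAlgebraic ℚ L.g₂ → IsAlgebraic ℚ L.g₃ → ∀ ω ∈ L.lattice, ω ≠ 0 →
    ∀ (k : ℕ) (β₀ : ℂ) (β y : Fin k → ℂ), IsAlgebraic ℚ β₀ → (∀ i, IsAlgebraic ℚ (β i)) →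
      (∀ i, IsAlgebraic ℚ (Complex.exp (y i))) → ω ≠ β₀ + ∑ i, β i * y i

/-! ### Proved specialisations -/

/-- **Non-zero periods are transcendental** (Siegel in the CM case, Schneider in general;
Baker–Wüstholz 2007, §6.1): the case `k = 0` of `ellipticPeriod_not_mem_logSpan`.
[cite: BakerWustholz2007, §6.1 (transcendence of the non-zero periods of ℘, deduced from Thm. 6.1)] -/
theorem ellipticPeriod_not_mem_logSpan.transcendental (h : ellipticPeriod_not_mem_logSpan)
    (L : PeriodPair) (h₂ : IsAlgebraic ℚ L.g₂) (h₃ : IsAlgebraic ℚ L.g₃) {ω : ℂ}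
    (hω : ω ∈ L.lattice) (hω0 : ω ≠ 0) : Transcendental ℚ ω := by
  intro halg
  have := h L h₂ h₃ ω hω hω0 0 ω (fun _ => 0) (fun _ => 0) halg (fun i => i.elim0)
    (fun i => i.elim0)
  simp at this

/-- **One logarithm**: for algebraic `α` and any `w` with `exp w = α`, and algebraic `β₀, β₁`,
`ω ≠ β₀ + β₁ w` (the case `k = 1`). [cite: HuberWustholz2022, Thm. 15.3(1) for [ℤ → 𝔾ₘ] × [0 → E]] -/
theorem ellipticPeriod_not_mem_logSpan.ne_add_mul_log (h : ellipticPeriod_not_mem_logSpan)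
    (L : PeriodPair) (h₂ : IsAlgebraic ℚ L.g₂) (h₃ : IsAlgebraic ℚ L.g₃) {ω : ℂ}
    (hω : ω ∈ L.lattice) (hω0 : ω ≠ 0) {α w β₀ β₁ : ℂ} (hα : IsAlgebraic ℚ α)
    (hw : Complex.exp w = α) (hβ₀ : IsAlgebraic ℚ β₀) (hβ₁ : IsAlgebraic ℚ β₁) :
    ω ≠ β₀ + β₁ * w := by
  have := h L h₂ h₃ ω hω hω0 1 β₀ (fun _ => β₁) (fun _ => w) hβ₀ (fun _ => hβ₁)
    (fun _ => by rwa [hw])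
  simpa using this

/-- **`ω ∉ ℚ̄·π`** (Schneider 1937: `π/ω` is transcendental): for algebraic `β`, `ω ≠ β·π`
— the case `k = 1`, `y = πi` (`e^{πi} = −1 ∈ ℚ̄`), `β₁ = −iβ`.
[cite: HuberWustholz2022, Prologue ("In particular he showed that π/ω is transcendental") and Thm. 15.3(1)] -/
theorem ellipticPeriod_not_mem_logSpan.ne_algebraic_mul_pi (h : ellipticPeriod_not_mem_logSpan)
    (L : PeriodPair) (h₂ : IsAlgebraic ℚ L.g₂) (h₃ : IsAlgebraic ℚ L.g₃) {ω : ℂ}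
    (hω : ω ∈ L.lattice) (hω0 : ω ≠ 0) {β : ℂ} (hβ : IsAlgebraic ℚ β) :
    ω ≠ β * Real.pi := by
  have hexp : IsAlgebraic ℚ (Complex.exp (Real.pi * I)) := by
    rw [Complex.exp_pi_mul_I]
    exact IsAlgebraic.neg isAlgebraic_one
  have hI : IsAlgebraic ℚ Complex.I := by
    refine ⟨Polynomial.X ^ 2 + 1, Polynomial.X_pow_add_C_ne_zero (by norm_num) 1, ?_⟩
    simp
  have hcoef : IsAlgebraic ℚ (-I * β) := IsAlgebraic.mul (IsAlgebraic.neg hI) hβ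
  have := h.ne_add_mul_log L h₂ h₃ hω hω0 hexp rfl isAlgebraic_zero hcoef
  intro hωπ
  apply this
  rw [hωπ, zero_add]
  ring_nf
  rw [Complex.I_sq]
  ring

end Literature.NumberTheory.Transcendental
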